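import Mathlib
import Literature.MathematicalPhysics.QuantumFieldTheory.Balaban1983to89.B9
import Literature.MathematicalPhysics.QuantumFieldTheory.Balaban1983to89.B6RandomWalk
import Literature.MathematicalPhysics.QuantumFieldTheory.Balaban1983to89.B9Thm34Ext

/-!
# `Balaban1983to89.B9Thm37Sum` — the summation step behind Theorem 3.7 and Corollary 3.8 of B9 ((3.87)–(3.94)), kernel-checked

T. Bałaban, *Propagators for lattice gauge theories in a background field*, Commun. Math. Phys. **99**, 389–434
(1985) [Balaban1985BackgroundPropagators] (cell paper B9; PDF held `paper:balaban1985-cmp99-background-propagators`,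
journal page = PDF page + 388).  Sibling of `…Balaban1983to89.B9` (UNTOUCHED: its by-reference leaves
`B9.Thm37Printed`, `B9.Cor38Printed` stay the statement-level nodes; its arithmetic `B9.walkFactor`,
`B9.walkSum_le`, `B9.split_small_factor` is REUSED), of `…Balaban1983to89.B6RandomWalk` (unit pv08: the block-majorant
calculus of [4] = [Balaban1984PropagatorsII] (2.51)–(2.66) — `HasMajorant`, `hasMajorant_mul`,
`majorant_of_fixedPoint_266` REUSED, not restated) and of `…Balaban1983to89.B9Thm34Ext` (the transport `toB6` of a B9
geometry to a B6 geometry, REUSED).  [3] = [Balaban1984PropagatorsI].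

CITATION HEADER (lean-in-tree rule 2026-08-18).  This module is a KERNEL-CHECKED BOOKKEEPING STEP of the published
paper [Balaban1985BackgroundPropagators], Sect. C, pp. 408–410 [PDF 20–22], verbatim:

> (p. 408) *"We take the partition of unity {h_□} defined at the end of Sect. A in [4]. We have Σ_{□∈𝒟} h²_□ = 1."*
> (p. 409) *"We construct approximations G′₀, C₀, G₀ of the operators G′, (Q′G′²Q′\*)^{−1}, G taking
> G′₀ = Σ_{□∈𝒟} h_□G′_□h_□, C₀ = Σ_{□∈𝒟} h_□C_□h_□, G₀ = Σ_{□∈𝒟} h_□G_□h_□. (3.87)  As in [4] we have to express the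
> operators Δ′_aG′₀, (Q′G′²Q′\*)C₀, Δ_aG₀ as small perturbations of identity. Let us start with the operator Δ′_aG′₀.
> Using (3.50) we get for x ∈ Δ(y), y ∈ Λ_j, (Δ′_ahλ)(x) = h(x)(Δ′_aλ)(x) − Σ_{b∈st(x)}(∂h)(b)(Dλ)(b) + (Δh)(x)λ(x) +
> a_j(L^jη)^{−2} Σ_{x′∈B^j(y)} L^{−jd}(∂h)(Γ^{(j)}_{x,y} ∪ Γ^{(j)}_{y,x′})R((U(Γ^{(j)}_{y,x}))^{−1}R(U(Γ^{(j)}_{y,x′}))λ(x′)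
> = h(x)(Δ′_aλ)(x) − (K(h)λ)(x), (3.88) hence Δ′_aG′₀ = I − Σ_{□∈𝒟} K(h_□)G′_□h_□ = I − R′.  Using the inequalities
> (3.42) for G′_□, we get the bound |(K(h_□)G′_□h_□λ)(x)| ≤ O(M^{−1})e^{−δ₀(L^jη)^{−1}|y−y′|}|λ| (3.89) for x ∈ Δ(y),
> supp λ ⊂ Δ(y′), y, y′ ∈ □ ∈ 𝒟_j.  It is exactly the bound (2.44) of [4], rescaled to η-scale. This bound was a basis
> of all the remaining considerations in that paper, connected with the convergence of the expansion (2.50), so we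
> may apply them here also. We get  Theorem 3.7. For M sufficiently large, and a configuration U satisfying (3.35),
> the operator G′ can be represented as G′ = G′₀(I − R′)^{−1} = G′₀Σ_{n=0}^∞ R′ⁿ
> = Σ_ω h_{□₀}G′_{□₀}h_{□₀}K(h_{□₁})G′_{□₁}h_{□₁}…K(h_{□ₙ})G′_{□ₙ}h_{□ₙ}, (3.90) where ω = (□₀, □₁, …, □ₙ), □ᵢ ∈ 𝒟,
> □ᵢ ∩ □ᵢ₊₁ ≠ ∅.  The expansion is convergent in all norms appearing in the inequalities (3.42)–(3.47)."*
> (p. 410) *"This theorem follows simply from Corollary 3.6 holding for all G′_□, □ ∈ 𝒟, from the bound (3.89) and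
> Lemma 2.1. The arguments are exactly the same as in proofs of Proposition 1.2 [3] and Proposition 2.2 [4], so we
> will not repeat them here.  Theorem 3.7 implies that all the inequalities (3.42)–(3.47) hold for G′, thus we have
> completed the proof of Theorem 3.1. … To describe it let us localize the term, inserting characteristic functions
> of Δ(y), y ∈ 𝔅, between the operators K(h_□)G′_□h_□. We get the sum
> Σ_{yᵢ∈□ᵢ∩𝔅, i=1,…,n} Δ(y)h_{□₀}G′_{□₀}h_{□₀}Δ(y₁)K(h_{□₁})G′_{□₁}h_{□₁}Δ(y₂)…Δ(yₙ)K(h_{□ₙ})G′_{□ₙ}h_{□ₙ}Δ(y′)λ, (3.91) and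
> each term in this sum can be estimated by O(1)(L^jη)²e^{−δ₀d(y,y₁)}O(M^{−1})e^{−δ₀d(y₁,y₂)}…O(M^{−1})e^{−δ₀d(yₙ,y′)}
> |Δ(y′)λ|. (3.92) … We use part of the exponentials to control the sum over yᵢ's, let us say the exponentials with
> ½δ₀ instead of δ₀, the remaining are used to construct an overall exponential factor. Let us define a distance
> relative to the walk ω by d(ω, y, y′) = inf_{(y₁,…,yₙ)}{d(y,y₁) + d(y₁,y₂) + … + d(y_{n−1},yₙ) + d(yₙ,y′)}, (3.93) the
> infimum is taken over all sequences (y₁, y₂, …, yₙ) of points yᵢ ∈ □ᵢ ∈ 𝔅 [sic]. Let us denote |ω| = n. …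
> Corollary 3.8. The term in the expansion (3.90) corresponding to a walk ω = (□₀, □₁, …, □ₙ) depends on U
> restricted to □̃⁵₀ ∪ □̃⁵₁ ∪ … ∪ □̃⁵ₙ, and |Δ(y)h_{□₀}G′_{□₀}h_{□₀}Π_{i=1}^n K(h_{□ᵢ})G′_{□ᵢ}h_{□ᵢ}Δ(y′)λ|
> ≤ O(1)(L^jη)²O(M^{−1/2})^{|ω|}M^{−½|ω|}e^{−½δ₀d(ω,y,y′)}|Δ(y′)λ| (3.94) for y ∈ □₀ ∩ Λ_j, y′ ∈ □ₙ.  Similar estimates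
> hold for the other norms.  We will use the factor O(M^{−1/2}) to control the sum over random walks ω"*.

Here "Corollary 3.6 … for all G′_□" = (3.42)–(3.47) with the constants of Cor. 3.6 for the propagators of the local
sequences {Ω_n(□)} (p. 409: *"The operators constructed for this sequence, which we denote by G′_□(U), …, satisfy
all the inequalities of Theorems 3.1–3.3 correspondingly"*), "Lemma 2.1" = (2.60)–(2.63) of [4] p. 234 (typed
`B6.Lemma21Printed`, `B6RandomWalk.Ineq261`/`Ineq263`), "Proposition 2.2 [4]" = (2.64)–(2.67) of [4] p. 234
(kernel-checked by pv08 as `B6RandomWalk.majorant_of_fixedPoint_266`), and (3.42)₁ = *"|G′λ| ≦ B₀(L^jη)²e^{−δ₀d(y,y′)}|λ|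
for x ∈ Δ(y), y ∈ Λ_j, supp λ ⊂ Δ(y′), y′ ∈ 𝔅"* (p. 397 [PDF 9]).  In (3.88) the second display line (the sum
over x′ ∈ B^j(y), restored in v1.1 of this header — GAPS G-pv21g5-6; render `…-p021-x2.png` re-read as an image by
b09-g8) is the commutator with h of the AVERAGING part Q′\*aQ′ of Δ′_a = (Δ^η_U + Q′\*aQ′)↾_{Ω₀} (p. 394, between (3.23)
and (3.24); cf. [4] (2.40) p. 230, third term: h_□ is a smooth profile, not constant on the averaging blocks B^j(y));
it is part of K(h).
The parentheses of «R((U(Γ^{(j)}_{y,x}))^{−1}R(U(Γ^{(j)}_{y,x′}))λ(x′)» are reproduced as printed (one «)» short) and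
the last superscript prints «(j» [sic].  In this module K(h_□) is an ABSTRACT ring element (`h388` of `eq388_sum`:
Δ′_a∘h_□ = h_□∘Δ′_a − K(h_□)), so both display lines of (3.88) are covered and neither is modelled; any CONCRETE model
of K(h_□) must keep the Q′\*aQ′-commutator (size O(M^{−1})(L^jη)^{−2} within blocks by the count recorded in
G-pv21g5-6, a_j(L^jη)^{−2}·L^{−jd}·#B^j(y)·|∂h|·|Γ| — commentary, not a kernel hypothesis; it is what (3.89) absorbs).
(v1.1 = b09-g8 DOCFIX G-pv21g5-6: docstring only, every declaration byte-identical to v1 p178231.)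

WHAT IS REPRODUCED (0 sorry) — the arguments the print declines to repeat (*"so we will not repeat them here"*),
for the FIRST ENTRY of (3.42) (the sup bound), along BOTH printed routes, with every O(·) a named constant:
* §1 `hasMajorant_finsetSum`, `hasMajorant_localSum`, `mulOp`, `sum_mulOp_sq`, `hasMajorant_sandwich` — sums of
  LOCALIZED operators in the majorant calculus of [4]: if each T_□ has majorant χ_□(y)κ(y,y′) and Σ_□χ_□ ≤ N then Σ_□T_□
  has majorant Nκ ((3.87): G′₀; (3.89) summed: R′); h_□(·)h_□ preserves majorants (|h_□| ≤ 1) and Σ_□h_□(·)h_□ = I.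
* §2 `lprod`, `lchain`, `hasMajorant_lprod` — **(3.91)**: the product of the n + 1 factors of a walk term has the
  chain Σ_{y₁…yₙ}K₀(y,y₁)K₁(y₁,y₂)⋯Kₙ(yₙ,y′) of their majorants as majorant (inserting Σ_yΔ(y) = I, [4] (2.52)).
* §3 `LB`, `LB_dist`, `lchain_weight_le` — **(3.92)–(3.93) ⇒ (3.94)**: (3.93) typed by its defining property (D is an
  admissible lower bound of the path lengths through □₁∩𝔅, …, □ₙ∩𝔅; d(y,y′) is one by (2.54)), and the chain estimate:
  kernels wᵢ(y)e^{−δ₀d} with w₁, …, wₙ ≤ Θ (= O(M^{−1})) supported in Sᵢ and row sums Σ_ze^{−αδ₀d(y,z)} ≤ c give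
  ≤ w₀(y)(Θc)ⁿe^{−(1−α)δ₀D} — the printed *"exponentials with ½δ₀"* is α = ½, c = c₁(½) of [4] (2.61).
* §4 `walksFrom`, `card_walksFrom_le`, `mem_walksFrom` — the walks of (3.90) from a fixed □₀ as lists and the count
  ≤ Dⁿ when every cube meets at most D cubes (*"the factor O(M^{−1/2}) to control the sum over random walks"*).
* §5 `eq388_sum` — **"hence Δ′_aG′₀ = I − R′"** from (3.88) (Δ′_a∘h_□ = h_□∘Δ′_a − K(h_□)), the local-inverse property
  h_□Δ′_aG′_□h_□ = h²_□ and Σh²_□ = I, in any ring; `fixedPoint_of_388` — G′Δ′_a = I and Δ′_aG′₀ = I − R′ give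
  G′ = G′₀ + G′R′ ((3.90)'s first equality in the form the estimates consume); `hasMajorant_sandwich_local` — the terms
  h_□G′_□h_□ of (3.87) carry the majorant 1_{S_□}(y)·(majorant of G′_□); **`thm37_entry1`** — THEOREM 3.7 ⇒ (3.42)₁ FOR
  G′ along Proposition 2.2 [4]: from Cor. 3.6 entry 1 for every G′_□ (localized, overlap ≤ N), (3.89) (localized,
  overlap ≤ N′, O(M^{−1}) = θ), Lemma 2.1 at the exponent α and N′θc₁(α) < 1:
  |(G′λ)(x)| ≤ NB₀c₁(α)(1 − N′θc₁(α))^{−1}(L^jη)²e^{−(1−α)δ₀d(y,y′)}|λ|; **`thm37_entry1_explicit`** — *"For M sufficiently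
  large"* made a NUMBER: θ = θ₀M^{−1} and M ≥ M₂ := 2N′θ₀c₁(α) give the constant 2NB₀c₁(α) and the rate (1 − α)δ₀
  (p. 410: *"We can get a decay rate arbitrarily close to the decay rate of the localized propagators"* = α free).
* §6 **`cor38_walk_majorant`** — COROLLARY 3.8's (3.94) for the term of a walk with |ω| = n, constants explicit:
  majorant 1_{□₀∩𝔅}(y)B₀(L^jη)²(θc₁(α))ⁿe^{−(1−α)δ₀dω(y,y′)} for any admissible dω ((3.93)); **`cor38_bound_394`** — the
  same in print shape (α = ½, θ = θ₀M^{−1}): (L^jη)²·`B9.walkFactor B₀ (θ₀c₁(½)) M δ₀ n (dω y y′)`·|λ|, i.e. the printed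
  O(1) = B₀ and O(M^{−1/2}) = θ₀c₁(½)M^{−1/2}; **`walkSum_majorant`** — the Proposition 1.2 [3] route: with ≤ Dⁿ walks
  of length n from each □₀, overlap ≤ N and Dθc₁(α) ≤ ½ (*"M sufficiently large"* once more: M ≥ 2Dθ₀c₁(α)), EVERY
  partial sum of (3.90) has the majorant 2NB₀(L^jη)²e^{−(1−α)δ₀d(y,y′)} — the convergence *"in the norm"* of (3.42)₁.

WHAT IS NOT REPRODUCED (hypotheses of the printed shape, each named — none is a cited fact; the paper is under
adjudication by the cell and is quoted, not cited, for them): (i) the bound (3.89) itself (from (3.42)₁,₂ for G′_□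
and |∂h_□| ≤ O(1)(ML^jη)^{−1}, |Δh_□| ≤ O(1)(ML^jη)^{−2} of [4] Sect. A — hypotheses `h389` / `hR`; it mixes the
site- and bond-entries of (3.42), cell GAPS G-B9-07); (ii) (3.88) from (3.50) and the local-inverse property
h_□Δ′_aG′_□ = h_□ (locality of Δ′_a within Ω₀(□) ⊃ □̃ — hypotheses `h388`, `hloc` of `eq388_sum`; `thm37_entry1` takes the
summed identity Δ′_aG′₀ = I − R′ and G′Δ′_a = I as `h388`, `hinv`); (iii) the operator identity G′ = Σ_ω(…) of (3.90)
as a rearranged non-commutative power series — only its fixed-point form, the per-walk terms and the majorants of all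
partial sums are typed (on the finite lattice this is what "convergent in the norm (3.42)₁" consumes); (iv) the other
norms (*"Similar estimates hold for the other norms"*: the ∇_U-, Hölder- and L²-entries (3.42)₂–(3.47) need pv08's
calculus between TWO function spaces — cell GAPS G-B9-02/G-B9-07, unit pv21's `B6RandomWalkHom`); (v) Lemma 2.1 of
[4] for THIS geometry — the (2.61)/(2.63)-shaped hypotheses `h261`, `h263` over `toB6 g R H`, as in `…B9Thm34Ext`;
(vi) the combinatorial constants: the overlap counts N, N′ of the cubes □̃ ⊃ supp h_□ over a coarse site and the
number D of cubes meeting a given one are HYPOTHESES (`hcnt`, `hcnt'`, `hD`) — in print they are among the constants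
"depending on d and L only" and are not computed there either; (vii) the exponent of (3.89) is printed with the scaled
Euclidean distance (L^jη)^{−1}|y − y′| inside one cube □ ∈ 𝒟_j, and is typed — as (2.44)/(2.51) of [4] are in
`…B6RandomWalk` — with the multiscale d(y,y′) (cell DIVERGENCE D-b09.13 records the dictionary); (viii) the
U-localisation clause of Corollary 3.8 (dependence on U↾∪□̃⁵ᵢ) — statement-level in `B9.Cor38Printed`, not typed here.
NOTHING of the series' end-statement (ultraviolet stability, [Balaban1987RG1] Thm 2 ff., under adjudication by the
cell `pub-balaban`) is asserted; value = kernel-checked bookkeeping of a printed "we will not repeat them here", NOT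
summit progress.  Unit `b2b-balaban-b09-g4` (paper sub-cell B09, gen 4), SHARPEN pass 2 of node T06.7/T06.8; cell rows
C-B9-20 (certification), G-B9-22 (located residuals (i), (ii), (vi)), D-b09.13.
-/

namespace Literature.MathematicalPhysics.QuantumFieldTheory.Balaban1983to89.B9Thm37Sum

open Literature.MathematicalPhysics.QuantumFieldTheory.Balaban1983to89
open Finset

/-! ## §1  Sums of localized operators in the block-majorant calculus of [4] ((3.87), (3.89)) -/

section Generic

variable {G : B6.Geometry} {X : Type}

/-- Finite sums of operators (over any index set): the majorants add up — [4] p. 232 *"A summation preserves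
it also"*, Finset-indexed form of `B6RandomWalk.hasMajorant_sum`. [folklore] -/
theorem hasMajorant_finsetSum (blk : X → G.Site) {ι : Type} (s : Finset ι)
    (T : ι → Module.End ℝ (X → ℝ)) (K : ι → G.Site → G.Site → ℝ)
    (h : ∀ i ∈ s, B6RandomWalk.HasMajorant blk (T i) (K i)) :
    B6RandomWalk.HasMajorant blk (∑ i ∈ s, T i) (fun a b => ∑ i ∈ s, K i a b) := by
  induction s using Finset.cons_induction with
  | empty => simpa using B6RandomWalk.hasMajorant_zero blk
  | cons i s hi ih =>
      have h' := B6RandomWalk.hasMajorant_add blk (h i (Finset.mem_cons_self i s))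
        (ih fun j hj => h j (Finset.mem_cons_of_mem hj))
      simpa [Finset.sum_cons] using h'

/-- LOCALISATION of a majorant on the observation side: if (Tμ)(x) = 0 whenever the block of x is not in the
finite set S (e.g. T = h_□(·)h_□ with supp h_□ met only by the blocks Δ(y), y ∈ S), then the majorant may be
cut down to 1_S(y)K(y, y′). [folklore] -/
theorem hasMajorant_restrict [DecidableEq G.Site] (blk : X → G.Site) {T : Module.End ℝ (X → ℝ)}
    {K : G.Site → G.Site → ℝ} (hT : B6RandomWalk.HasMajorant blk T K) (S : Finset G.Site)
    (hS : ∀ (μ : X → ℝ) (x : X), blk x ∉ S → T μ x = 0) :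
    B6RandomWalk.HasMajorant blk T (fun a b => if a ∈ S then K a b else 0) := by
  intro y' μ B hμ x
  by_cases hx : blk x ∈ S
  · simpa [hx] using hT y' μ B hμ x
  · rw [hS μ x hx]
    simp [hx]

/-- **Sums of LOCALIZED operators** (the mechanism behind (3.87) G′₀ = Σ_□ h_□G′_□h_□ and R′ = Σ_□ K(h_□)G′_□h_□,
p. 409): if every T_□ has the majorant χ_□(y)κ(y, y′) with a common κ ≥ 0 and localisation weights χ_□ ≥ 0 (χ_□ = the
indicator of the coarse sites whose block meets supp h_□ ⊂ □̃), and Σ_□ χ_□(y) ≤ N for every y (finite overlap of the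
cubes □̃), then Σ_□ T_□ has majorant N·κ(y, y′). [cite: Balaban1985BackgroundPropagators, (3.87)–(3.89) p.409] -/
theorem hasMajorant_localSum (blk : X → G.Site) {ι : Type} [Fintype ι]
    (T : ι → Module.End ℝ (X → ℝ)) (χ : ι → G.Site → ℝ) (κ : G.Site → G.Site → ℝ) (N : ℝ)
    (hκ : ∀ a b, 0 ≤ κ a b) (hT : ∀ i, B6RandomWalk.HasMajorant blk (T i) (fun a b => χ i a * κ a b))
    (hN : ∀ a, ∑ i, χ i a ≤ N) :
    B6RandomWalk.HasMajorant blk (∑ i, T i) (fun a b => N * κ a b) := by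
  refine B6RandomWalk.hasMajorant_mono blk
    (hasMajorant_finsetSum blk Finset.univ T _ fun i _ => hT i) fun a b => ?_
  calc (∑ i, χ i a * κ a b) = (∑ i, χ i a) * κ a b := by rw [Finset.sum_mul]
    _ ≤ N * κ a b := mul_le_mul_of_nonneg_right (hN a) (hκ a b)

/-- The operator of multiplication by a lattice function h (the h_□ of the partition of unity {h_□}, p. 408:
*"We take the partition of unity {h_□} defined at the end of Sect. A in [4]. We have Σ_{□∈𝒟} h²_□ = 1"*).
[cite: Balaban1985BackgroundPropagators, (3.87) p.409] -/
def mulOp (h : X → ℝ) : Module.End ℝ (X → ℝ) where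
  toFun μ := fun x => h x * μ x
  map_add' μ ν := by
    funext x
    simp only [Pi.add_apply]
    ring
  map_smul' r μ := by
    funext x
    simp only [Pi.smul_apply, smul_eq_mul, RingHom.id_apply]
    ring

/-- Unfolding equation of `mulOp`. [folklore] -/
@[simp] theorem mulOp_apply (h μ : X → ℝ) (x : X) : mulOp h μ x = h x * μ x := rfl

omit G in
/-- Σ_□ h_□² = 1 (p. 408) as an operator identity: Σ_□ h_□(·)h_□ = I. [cite: Balaban1985BackgroundPropagators, p.408] -/
theorem sum_mulOp_sq {ι : Type} [Fintype ι] (h : ι → X → ℝ) (hsq : ∀ x, ∑ i, h i x ^ 2 = 1) :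
    ∑ i, mulOp (h i) * mulOp (h i) = (1 : Module.End ℝ (X → ℝ)) := by
  apply LinearMap.ext
  intro μ
  funext x
  rw [LinearMap.coe_sum, Finset.sum_apply, Finset.sum_apply]
  simp only [Module.End.mul_apply, mulOp_apply, Module.End.one_apply]
  calc ∑ i, h i x * (h i x * μ x) = (∑ i, h i x ^ 2) * μ x := by
        rw [Finset.sum_mul]
        exact Finset.sum_congr rfl fun i _ => by ring
    _ = μ x := by rw [hsq x, one_mul]

/-- **h_□G′_□h_□ inherits the majorant of G′_□** (|h_□| ≤ 1): the terms of (3.87) obey Corollary 3.6's bound for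
G′_□ — *"The operators constructed for this sequence, which we denote by G′_□(U), … satisfy all the inequalities of
Theorems 3.1–3.3 correspondingly"* (p. 409). [cite: Balaban1985BackgroundPropagators, (3.87) p.409] -/
theorem hasMajorant_sandwich (blk : X → G.Site) {Gop : Module.End ℝ (X → ℝ)} {K : G.Site → G.Site → ℝ}
    (hG : B6RandomWalk.HasMajorant blk Gop K) (h : X → ℝ) (hh : ∀ x, |h x| ≤ 1) :
    B6RandomWalk.HasMajorant blk (mulOp h * Gop * mulOp h) K := by
  intro y' μ B hμ x
  have hμ' : B6RandomWalk.BlockSupp blk (mulOp h μ) y' B := by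
    refine ⟨hμ.nonneg, fun x hx => ?_, fun x hx => ?_⟩
    · rw [mulOp_apply, abs_mul]
      calc |h x| * |μ x| ≤ 1 * B := mul_le_mul (hh x) (hμ.bound x hx) (abs_nonneg _) zero_le_one
        _ = B := one_mul B
    · simp [hμ.off x hx]
  have hb := hG y' _ B hμ' x
  rw [Module.End.mul_apply, Module.End.mul_apply, mulOp_apply, abs_mul]
  calc |h x| * |Gop (mulOp h μ) x| ≤ 1 * (K (blk x) y' * B) := mul_le_mul (hh x) hb (abs_nonneg _) zero_le_one
    _ = K (blk x) y' * B := one_mul _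

omit G in
/-- h_□G′_□h_□ vanishes off supp h_□ (observation side). [folklore] -/
theorem sandwich_apply_eq_zero {Gop : Module.End ℝ (X → ℝ)} (h μ : X → ℝ) (x : X) (hx : h x = 0) :
    (mulOp h * Gop * mulOp h) μ x = 0 := by
  rw [Module.End.mul_apply, Module.End.mul_apply, mulOp_apply, hx, zero_mul]

/-! ## §2  Products along a walk: left-nested operator products and their chain majorants ((3.90)–(3.92)) -/

/-- The left-nested product F₀·(F₁·(⋯·Fₙ)) of the first n + 1 operators of a sequence — the term
h_{□₀}G′_{□₀}h_{□₀}K(h_{□₁})G′_{□₁}h_{□₁}⋯K(h_{□ₙ})G′_{□ₙ}h_{□ₙ} of (3.90) for F₀ = h_{□₀}G′_{□₀}h_{□₀}, Fᵢ = K(h_{□ᵢ})G′_{□ᵢ}h_{□ᵢ}.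
[cite: Balaban1985BackgroundPropagators, (3.90) p.409] -/
def lprod : (ℕ → Module.End ℝ (X → ℝ)) → ℕ → Module.End ℝ (X → ℝ)
  | F, 0 => F 0
  | F, n + 1 => F 0 * lprod (fun i => F (i + 1)) n

/-- The matching chain of majorants Σ_{y₁,…,yₙ} K₀(y,y₁)K₁(y₁,y₂)⋯Kₙ(yₙ,y′) (sum over the first intermediate point
first) — the shape of the sum (3.91) estimated term by term in (3.92). [cite: Balaban1985BackgroundPropagators, (3.91)–(3.92) p.410] -/
def lchain {S : Type} [Fintype S] : (ℕ → S → S → ℝ) → ℕ → S → S → ℝ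
  | K, 0 => K 0
  | K, n + 1 => fun a b => ∑ z, K 0 a z * lchain (fun i => K (i + 1)) n z b

omit G X in
/-- Chains of non-negative kernels are non-negative (only K 0, …, K n are read). [folklore] -/
theorem lchain_nonneg {S : Type} [Fintype S] :
    ∀ (n : ℕ) (K : ℕ → S → S → ℝ), (∀ i ≤ n, ∀ a b, 0 ≤ K i a b) → ∀ a b, 0 ≤ lchain K n a b
  | 0, K, hK, a, b => hK 0 le_rfl a b
  | n + 1, K, hK, a, b =>
      Finset.sum_nonneg fun z _ =>
        mul_nonneg (hK 0 (Nat.zero_le _) a z)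
          (lchain_nonneg n (fun i => K (i + 1)) (fun i hi => hK (i + 1) (by omega)) z b)

omit G X in
/-- A chain whose first kernel vanishes at the initial point vanishes. [folklore] -/
theorem lchain_eq_zero_of_head {S : Type} [Fintype S] (K : ℕ → S → S → ℝ) (n : ℕ) (a b : S)
    (h0 : ∀ z, K 0 a z = 0) : lchain K n a b = 0 := by
  cases n with
  | zero => exact h0 b
  | succ n =>
      show ∑ z, K 0 a z * lchain (fun i => K (i + 1)) n z b = 0
      exact Finset.sum_eq_zero fun z _ => by rw [h0 z, zero_mul]

/-- **(2.52)/(2.55)ₐ of [4] along a walk**: if every factor Fᵢ has a majorant Kᵢ ≥ 0, the product F₀F₁⋯Fₙ has the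
chain Σ_{y₁…yₙ}K₀(y,y₁)⋯Kₙ(yₙ,y′) as majorant (insert Σ_{yᵢ}Δ(yᵢ) = I between the factors — exactly the
*"inserting characteristic functions of Δ(y), y ∈ 𝔅, between the operators K(h_□)G′_□h_□"* of p. 410 giving (3.91)).
[cite: Balaban1985BackgroundPropagators, (3.91) p.410] -/
theorem hasMajorant_lprod (blk : X → G.Site) (F : ℕ → Module.End ℝ (X → ℝ)) (K : ℕ → G.Site → G.Site → ℝ) :
    ∀ n : ℕ, (∀ i ≤ n, B6RandomWalk.HasMajorant blk (F i) (K i)) → (∀ i ≤ n, ∀ a b, 0 ≤ K i a b) →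
      B6RandomWalk.HasMajorant blk (lprod F n) (lchain K n) := by
  intro n
  induction n generalizing F K with
  | zero => exact fun h _ => h 0 le_rfl
  | succ n ih =>
      intro h hK
      have htail := ih (fun i => F (i + 1)) (fun i => K (i + 1)) (fun i hi => h (i + 1) (by omega))
        (fun i hi => hK (i + 1) (by omega))
      exact B6RandomWalk.hasMajorant_mul blk (h 0 (Nat.zero_le _)) htail
        (lchain_nonneg n _ (fun i hi => hK (i + 1) (by omega)))

/-! ## §3  (3.93): restricted path lengths, and the bound (3.92) ⇒ (3.94) on restricted chains -/

omit G X in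
/-- **The distance relative to a walk, (3.93)** (p. 410, verbatim: *"d(ω, y, y′) = inf_{(y₁,y₂,…,yₙ)}(d(y, y₁) +
d(y₁, y₂) + … + d(y_{n−1}, yₙ) + d(yₙ, y′)), (3.93) the infimum is taken over all sequences (y₁, y₂, …, yₙ) of points
yᵢ ∈ □ᵢ ∈ 𝔅 [sic]"*), typed by its defining property: `LB d S n y y′ D` says that D is a LOWER BOUND of all the path
lengths d(y,y₁) + ⋯ + d(yₙ,y′) with yᵢ ∈ S i (i = 1, …, n; S 0 is not read) — so d(ω, y, y′) is the largest such D,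
and every consequence below holds for it. Recursion on the first intermediate point (the tail uses the shifted
family S(· + 1)). [cite: Balaban1985BackgroundPropagators, (3.93) p.410] -/
def LB {St : Type} (d : St → St → ℝ) : (ℕ → Finset St) → ℕ → St → St → ℝ → Prop
  | _, 0, a, b, D => D ≤ d a b
  | S, n + 1, a, b, D => ∀ z ∈ S 1, LB d (fun i => S (i + 1)) n z b (D - d a z)

omit G X in
/-- Lower bounds may be lowered. [folklore] -/
theorem LB_mono {St : Type} (d : St → St → ℝ) :
    ∀ (n : ℕ) (S : ℕ → Finset St) (a b : St) (D D' : ℝ), LB d S n a b D → D' ≤ D → LB d S n a b D'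
  | 0, S, a, b, D, D', h, hle => le_trans hle h
  | n + 1, S, a, b, D, D', h, hle => fun z hz =>
      LB_mono d n (fun i => S (i + 1)) z b (D - d a z) (D' - d a z) (h z hz) (by linarith)

omit G X in
/-- **(2.54) of [4] ⇒ d(y, y′) ≤ d(ω, y, y′)**: by the triangle inequality every admissible path length is at least
d(y, y′), i.e. d(y, y′) is an admissible lower bound (so e^{−½δ₀d(ω,y,y′)} ≤ e^{−½δ₀d(y,y′)}, the overall exponential
factor of Theorem 3.1). [cite: Balaban1984PropagatorsII, (2.54) p.233] -/
theorem LB_dist {St : Type} (d : St → St → ℝ) (htri : ∀ a b c : St, d a c ≤ d a b + d b c) :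
    ∀ (n : ℕ) (S : ℕ → Finset St) (a b : St), LB d S n a b (d a b)
  | 0, S, a, b => le_rfl
  | n + 1, S, a, b => fun z _ =>
      LB_mono d n (fun i => S (i + 1)) z b (d z b) (d a b - d a z) (LB_dist d htri n _ z b)
        (by linarith [htri a z b])

omit G X in
/-- **(3.92) ⇒ (3.94), the chain estimate** (p. 410, verbatim: *"We use part of the exponentials to control the sum
over yᵢ's, let us say the exponentials with ½δ₀ instead of δ₀, the remaining are used to construct an overall
exponential factor"*).  For kernels Kᵢ(y, z) = wᵢ(y)e^{−δ₀d(y,z)} with weights 0 ≤ wᵢ ≤ Θ for i ≥ 1 vanishing off Sᵢ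
(Θ = the O(M⁻¹) of (3.89), Sᵢ = □ᵢ ∩ 𝔅; w₀ = O(1)(L^jη)² on □₀ is free), the row-sum bound Σ_z e^{−αδ₀d(y,z)} ≤ c
((2.61) of [4]: c = c₁(α); α = ½ in print) and an admissible lower bound D of the path lengths through S₁, …, Sₙ
((3.93)): the chain is ≤ w₀(y)(Θc)ⁿe^{−(1−α)δ₀D}. [cite: Balaban1985BackgroundPropagators, (3.92)–(3.94) p.410] -/
theorem lchain_weight_le {St : Type} [Fintype St] (d : St → St → ℝ) (δ₀ α c Θ : ℝ)
    (hdnn : ∀ a b, 0 ≤ d a b) (hαδ : 0 ≤ α * δ₀) (h1αδ : 0 ≤ (1 - α) * δ₀) (hΘ : 0 ≤ Θ)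
    (hrow : ∀ a, ∑ b, Real.exp (-(α * δ₀ * d a b)) ≤ c) :
    ∀ (n : ℕ) (S : ℕ → Finset St) (w : ℕ → St → ℝ), (∀ i ≤ n, ∀ a, 0 ≤ w i a) →
      (∀ i, 1 ≤ i → i ≤ n → ∀ a, w i a ≤ Θ) → (∀ i, 1 ≤ i → i ≤ n → ∀ a, a ∉ S i → w i a = 0) →
      ∀ (a b : St) (D : ℝ), LB d S n a b D →
        lchain (fun i y z => w i y * Real.exp (-(δ₀ * d y z))) n a b ≤
          w 0 a * (Θ * c) ^ n * Real.exp (-((1 - α) * δ₀ * D)) := by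
  intro n
  induction n with
  | zero =>
      intro S w hw0 _ _ a b D hD
      change w 0 a * Real.exp (-(δ₀ * d a b)) ≤ _
      have hD' : D ≤ d a b := hD
      have hexp : Real.exp (-(δ₀ * d a b)) ≤ Real.exp (-((1 - α) * δ₀ * D)) := by
        refine Real.exp_le_exp.mpr ?_
        have h1 := mul_le_mul_of_nonneg_left hD' h1αδ
        have h2 := mul_nonneg hαδ (hdnn a b)
        nlinarith [h1, h2]
      calc w 0 a * Real.exp (-(δ₀ * d a b)) ≤ w 0 a * Real.exp (-((1 - α) * δ₀ * D)) :=
            mul_le_mul_of_nonneg_left hexp (hw0 0 le_rfl a)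
        _ = _ := by rw [pow_zero, mul_one]
  | succ n ih =>
      intro S w hw0 hwΘ hwS a b D hD
      change ∑ z, w 0 a * Real.exp (-(δ₀ * d a z)) *
          lchain (fun i y z => w (i + 1) y * Real.exp (-(δ₀ * d y z))) n z b ≤ _
      have hc : 0 ≤ c := le_trans (Finset.sum_nonneg fun b _ => (Real.exp_pos _).le) (hrow a)
      set E : ℝ := (Θ * c) ^ n * Real.exp (-((1 - α) * δ₀ * D)) with hE
      -- the tail chain from z, bounded uniformly in z by Θ (Θc)ⁿ e^{−(1−α)δ₀(D − d(a,z))}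
      have htail : ∀ z, lchain (fun i y z => w (i + 1) y * Real.exp (-(δ₀ * d y z))) n z b ≤
          Θ * ((Θ * c) ^ n * Real.exp (-((1 - α) * δ₀ * (D - d a z)))) := by
        intro z
        have hpos : 0 ≤ (Θ * c) ^ n * Real.exp (-((1 - α) * δ₀ * (D - d a z))) :=
          mul_nonneg (pow_nonneg (mul_nonneg hΘ hc) n) (Real.exp_nonneg _)
        by_cases hz : z ∈ S 1
        · have h := ih (fun i => S (i + 1)) (fun i => w (i + 1)) (fun i hi y => hw0 (i + 1) (by omega) y)
            (fun i _ hi y => hwΘ (i + 1) (by omega) (by omega) y)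
            (fun i _ hi y hy => hwS (i + 1) (by omega) (by omega) y hy) z b (D - d a z) (hD z hz)
          refine h.trans ?_
          calc w (0 + 1) z * (Θ * c) ^ n * Real.exp (-((1 - α) * δ₀ * (D - d a z)))
              = w (0 + 1) z * ((Θ * c) ^ n * Real.exp (-((1 - α) * δ₀ * (D - d a z)))) := by ring
            _ ≤ Θ * ((Θ * c) ^ n * Real.exp (-((1 - α) * δ₀ * (D - d a z)))) :=
                mul_le_mul_of_nonneg_right (hwΘ 1 le_rfl (by omega) z) hpos
        · have h0 : lchain (fun i y z => w (i + 1) y * Real.exp (-(δ₀ * d y z))) n z b = 0 :=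
            lchain_eq_zero_of_head _ n z b fun z' => by rw [hwS 1 le_rfl (by omega) z hz, zero_mul]
          rw [h0]
          exact mul_nonneg hΘ hpos
      -- each summand ≤ w₀(a) · Θ E · e^{−αδ₀d(a,z)}
      have hterm : ∀ z, w 0 a * Real.exp (-(δ₀ * d a z)) *
            lchain (fun i y z => w (i + 1) y * Real.exp (-(δ₀ * d y z))) n z b ≤
          w 0 a * Θ * E * Real.exp (-(α * δ₀ * d a z)) := by
        intro z
        have hsplit : Real.exp (-(δ₀ * d a z)) * Real.exp (-((1 - α) * δ₀ * (D - d a z))) =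
            Real.exp (-((1 - α) * δ₀ * D)) * Real.exp (-(α * δ₀ * d a z)) := by
          rw [← Real.exp_add, ← Real.exp_add]
          congr 1
          ring
        calc w 0 a * Real.exp (-(δ₀ * d a z)) * lchain (fun i y z => w (i + 1) y * Real.exp (-(δ₀ * d y z))) n z b
            ≤ w 0 a * Real.exp (-(δ₀ * d a z)) * (Θ * ((Θ * c) ^ n * Real.exp (-((1 - α) * δ₀ * (D - d a z))))) :=
              mul_le_mul_of_nonneg_left (htail z) (mul_nonneg (hw0 0 (Nat.zero_le _) a) (Real.exp_nonneg _))
          _ = w 0 a * Θ * (Θ * c) ^ n *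
                (Real.exp (-(δ₀ * d a z)) * Real.exp (-((1 - α) * δ₀ * (D - d a z)))) := by ring
          _ = w 0 a * Θ * E * Real.exp (-(α * δ₀ * d a z)) := by rw [hsplit, hE]; ring
      have hCnn : 0 ≤ w 0 a * Θ * E :=
        mul_nonneg (mul_nonneg (hw0 0 (Nat.zero_le _) a) hΘ)
          (mul_nonneg (pow_nonneg (mul_nonneg hΘ hc) n) (Real.exp_nonneg _))
      calc ∑ z, w 0 a * Real.exp (-(δ₀ * d a z)) * lchain (fun i y z => w (i + 1) y * Real.exp (-(δ₀ * d y z))) n z b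
          ≤ ∑ z, w 0 a * Θ * E * Real.exp (-(α * δ₀ * d a z)) := Finset.sum_le_sum fun z _ => hterm z
        _ = w 0 a * Θ * E * ∑ z, Real.exp (-(α * δ₀ * d a z)) := by rw [Finset.mul_sum]
        _ ≤ w 0 a * Θ * E * c := mul_le_mul_of_nonneg_left (hrow a) hCnn
        _ = w 0 a * (Θ * c) ^ (n + 1) * Real.exp (-((1 - α) * δ₀ * D)) := by rw [hE]; ring

end Generic

/-! ## §4  Counting walks: *"We will use the factor O(M^{−1/2}) to control the sum over random walks ω"* (p. 410) -/

section WalkCount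

variable {ι : Type} [DecidableEq ι]

/-- The walks ω = (□₀, □₁, …, □ₙ) of (3.90) from a fixed □₀ = c with n steps, as lists, when `nbrs □` lists the
cubes □′ with □ ∩ □′ ≠ ∅ (□ itself included): *"where ω = (□₀, □₁, ⋯, □ₙ), □ᵢ ∈ 𝒟, □ᵢ ∩ □ᵢ₊₁ ≠ ∅"* (p. 409).
[cite: Balaban1985BackgroundPropagators, (3.90) p.409] -/
def walksFrom (nbrs : ι → Finset ι) : ℕ → ι → Finset (List ι)
  | 0, c => {[c]}
  | n + 1, c => (nbrs c).biUnion fun c' => (walksFrom nbrs n c').image (List.cons c)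

/-- **The walk count**: at most Dⁿ walks of n steps from a fixed cube when every cube meets at most D cubes
(D = 3^d for the cubes of one family 𝒟_j; a constant depending on d, L across scales).  This is the count the factor
O(M^{−1/2})^{|ω|} of (3.94) has to beat. [folklore] -/
theorem card_walksFrom_le (nbrs : ι → Finset ι) {D : ℕ} (hD : ∀ c, (nbrs c).card ≤ D) :
    ∀ (n : ℕ) (c : ι), (walksFrom nbrs n c).card ≤ D ^ n
  | 0, c => by simp [walksFrom]
  | n + 1, c => by
      rw [walksFrom]
      calc ((nbrs c).biUnion fun c' => (walksFrom nbrs n c').image (List.cons c)).card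
          ≤ ∑ c' ∈ nbrs c, ((walksFrom nbrs n c').image (List.cons c)).card := card_biUnion_le
        _ ≤ ∑ _c' ∈ nbrs c, D ^ n :=
            sum_le_sum fun c' _ => card_image_le.trans (card_walksFrom_le nbrs hD n c')
        _ = (nbrs c).card * D ^ n := by rw [sum_const, smul_eq_mul]
        _ ≤ D * D ^ n := Nat.mul_le_mul_right _ (hD c)
        _ = D ^ (n + 1) := by ring

/-- Completeness of the enumeration: every chain c :: l of consecutive neighbours is listed in
`walksFrom nbrs l.length c`. [folklore] -/
theorem mem_walksFrom (nbrs : ι → Finset ι) :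
    ∀ (l : List ι) (c : ι), List.IsChain (fun a b => b ∈ nbrs a) (c :: l) → c :: l ∈ walksFrom nbrs l.length c
  | [], c, _ => by simp [walksFrom]
  | c' :: l, c, hc => by
      rw [List.length_cons, walksFrom, mem_biUnion]
      exact ⟨c', (List.isChain_cons_cons.1 hc).1,
        mem_image.2 ⟨c' :: l, mem_walksFrom nbrs l c' (List.isChain_cons_cons.1 hc).2, rfl⟩⟩

/-- Lists in `walksFrom nbrs n c` start at c and have n + 1 entries. [folklore] -/
theorem head_length_of_mem_walksFrom (nbrs : ι → Finset ι) :
    ∀ (n : ℕ) (c : ι) (l : List ι), l ∈ walksFrom nbrs n c → l.head? = some c ∧ l.length = n + 1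
  | 0, c, l, hl => by
      simp only [walksFrom, mem_singleton] at hl
      subst hl
      simp
  | n + 1, c, l, hl => by
      rw [walksFrom, mem_biUnion] at hl
      obtain ⟨c', _, hl'⟩ := hl
      obtain ⟨l', hl'', rfl⟩ := mem_image.1 hl'
      have := head_length_of_mem_walksFrom nbrs n c' l' hl''
      simp [this.2]

end WalkCount


/-! ## §5  Theorem 3.7 ⇒ (3.42)₁ for G′ — the summation step of p. 410 along the route of Proposition 2.2 [4] -/

section Thm37

variable {g : B9.Geometry} [Fintype g.Site] [DecidableEq g.Site] {R : ℝ} {H : Prop} {X : Type}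

/-- **"hence Δ′_aG′₀ = I − Σ_□K(h_□)G′_□h_□ = I − R′"** (p. 409, the display after (3.88)), kernel-checked from three
operator identities of the printed shape: (3.88) *"(Δ′_ahλ)(x) = h(x)(Δ′_aλ)(x) − (K(h)λ)(x)"* for every h = h_□
(`h388`: Δ′_a∘h_□ = h_□∘Δ′_a − K(h_□)); the LOCAL INVERSE property h_□Δ′_aG′_□h_□ = h²_□ (`hloc`: G′_□ inverts Δ′_a on
functions living where h_□ does — G′_□ is the propagator of the sequence {Ω_n(□)}, Ω₀(□) ⊃ □̃, p. 408); and
Σ_□h²_□ = I (`hpu`, p. 408 *"We have Σ_{□∈𝒟} h²_□ = 1"*).  Pure non-commutative algebra.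
[cite: Balaban1985BackgroundPropagators, (3.87)–(3.88) p.409] -/
theorem eq388_sum {A : Type*} [Ring A] {ι : Type} [Fintype ι] (Δ : A) (Hm Gl Kh : ι → A)
    (h388 : ∀ i, Δ * Hm i = Hm i * Δ - Kh i) (hloc : ∀ i, Hm i * Δ * Gl i * Hm i = Hm i * Hm i)
    (hpu : ∑ i, Hm i * Hm i = 1) :
    Δ * (∑ i, Hm i * Gl i * Hm i) = 1 - ∑ i, Kh i * Gl i * Hm i := by
  rw [Finset.mul_sum]
  have hterm : ∀ i, Δ * (Hm i * Gl i * Hm i) = Hm i * Hm i - Kh i * Gl i * Hm i := fun i => by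
    calc Δ * (Hm i * Gl i * Hm i) = (Δ * Hm i) * Gl i * Hm i := by simp only [mul_assoc]
      _ = (Hm i * Δ - Kh i) * Gl i * Hm i := by rw [h388 i]
      _ = Hm i * Δ * Gl i * Hm i - Kh i * Gl i * Hm i := by rw [sub_mul, sub_mul]
      _ = Hm i * Hm i - Kh i * Gl i * Hm i := by rw [hloc i]
  simp_rw [hterm]
  rw [Finset.sum_sub_distrib, hpu]

/-- **(3.90), first equality, as the fixed-point identity the estimates consume**: G′ = Δ′_a^{−1} (a left inverse:
G′Δ′_a = I) and Δ′_aG′₀ = I − R′ give G′₀ = G′ − G′R′, i.e. G′ = G′₀ + G′R′ — which is *"G′ = G′₀(I − R′)^{−1} =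
G′₀Σ_{n=0}^∞R′ⁿ"* read without inverting I − R′ (the shape `hfix` of [4] (2.50) in `B6RandomWalk.majorant_of_fixedPoint_266`).
[cite: Balaban1985BackgroundPropagators, (3.90) p.409] -/
theorem fixedPoint_of_388 {A : Type*} [Ring A] {G' Δ G0 R' : A} (hinv : G' * Δ = 1) (h388 : Δ * G0 = 1 - R') :
    G' = G0 + G' * R' := by
  have h : G' * (Δ * G0) = G' - G' * R' := by rw [h388, mul_sub, mul_one]
  rw [← mul_assoc, hinv, one_mul] at h
  rw [h, sub_add_cancel]

variable [Fintype X] [DecidableEq X]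

omit [Fintype X] [DecidableEq X] in
/-- **The terms of (3.87) are localized** — h_□G′_□h_□ has the majorant 1_{S_□}(y)K(y, y′) whenever G′_□ has the
majorant K, |h_□| ≤ 1 and supp h_□ only meets the blocks Δ(y), y ∈ S_□ (S_□ = □̃ ∩ 𝔅 for the partition of unity of
[4] Sect. A).  This manufactures the hypotheses `hT` of `thm37_entry1` / `hT0` of `cor38_walk_majorant` from
Corollary 3.6 for G′_□. [cite: Balaban1985BackgroundPropagators, (3.87) p.409] -/
theorem hasMajorant_sandwich_local (blk : X → g.Site) {Gop : Module.End ℝ (X → ℝ)} {K : g.Site → g.Site → ℝ}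
    (hG : B6RandomWalk.HasMajorant (g := B9Thm34Ext.toB6 g R H) blk Gop K) (h : X → ℝ) (hh : ∀ x, |h x| ≤ 1)
    (S : Finset g.Site) (hS : ∀ x, h x ≠ 0 → blk x ∈ S) :
    B6RandomWalk.HasMajorant (g := B9Thm34Ext.toB6 g R H) blk (mulOp h * Gop * mulOp h)
      (fun (a b : g.Site) => if a ∈ S then K a b else 0) := by
  intro y' μ B hμ x
  by_cases hx : blk x ∈ S
  · have hb := hasMajorant_sandwich (G := B9Thm34Ext.toB6 g R H) blk hG h hh y' μ B hμ x
    have e : (fun (a b : g.Site) => if a ∈ S then K a b else 0) (blk x) y' = K (blk x) y' := by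
      simp only [hx, if_true]
    rw [e]
    exact hb
  · have h0 : h x = 0 := by
      by_contra hne
      exact hx (hS x hne)
    rw [sandwich_apply_eq_zero (Gop := Gop) h μ x h0, abs_zero]
    have e : (fun (a b : g.Site) => if a ∈ S then K a b else 0) (blk x) y' = 0 := by
      simp only [hx, if_false]
    rw [e, zero_mul]

/-- **Theorem 3.7 ⇒ the first inequality (3.42) for G′, constants explicit** (p. 410 ll. 1–5: *"This theorem follows
simply from Corollary 3.6 holding for all G′_□, □ ∈ 𝒟, from the bound (3.89) and Lemma 2.1. The arguments are exactly
the same as in proofs of Proposition 1.2 [3] and Proposition 2.2 [4], so we will not repeat them here.  Theorem 3.7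
implies that all the inequalities (3.42)–(3.47) hold for G′, thus we have completed the proof of Theorem 3.1."*) —
the Proposition 2.2 [4] route, FIRST ENTRY (the sup bound |G′λ|), kernel-checked over B9's 𝔅, d, L^jη (through
`B9Thm34Ext.toB6`).  Hypotheses, all of the printed shape and each NAMED (none is a cited fact):
* `hT` — Corollary 3.6 for every G′_□, first entry of (3.42), for the term h_□G′_□h_□ of (3.87), LOCALIZED: majorant
  1_{S_□}(y)·B₀(L^jη)²e^{−δ₀d(y,y′)} (`hasMajorant_sandwich_local`), with the overlap count #{□ : y ∈ S_□} ≤ N (`hcnt`);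
* `h389` — **(3.89)** (p. 409, verbatim: *"Using the inequalities (3.42) for G′_□, we get the bound
  |(K(h_□)G′_□h_□λ)(x)| ≤ O(M^{−1})e^{−δ₀(L^jη)^{−1}|y−y′|}|λ| (3.89) for x ∈ Δ(y), supp λ ⊂ Δ(y′), y, y′ ∈ □ ∈ 𝒟_j.
  It is exactly the bound (2.44) of [4], rescaled to η-scale"*), typed with O(M^{−1}) = θ and — as (2.44)/(2.51) of
  [4] are in `…B6RandomWalk` — with the multiscale d(y, y′) in the exponent, LOCALIZED to S′_□ with overlap count ≤ N′
  (`hcnt'`).  The derivation of (3.89) from (3.42) for G′_□ and |∂h_□| ≤ O(1)(ML^jη)^{−1} is NOT reproduced here;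
* `hinv`, `h388` — G′Δ′_a = I and Δ′_aG′₀ = I − R′ (`eq388_sum` derives the latter from (3.88), the local inverse
  property and Σ_□h²_□ = 1);
* Lemma 2.1 of [4] for this geometry at the exponent α ((2.61) `h261`; (2.63) `h263`, which follows from (2.61) and
  the triangle inequality (2.54) `htri` by `B9Thm34Ext.h263_of_h261`), the metric facts d(y,y) = 0, d ≥ 0, and the
  LOCATED smallness N′θc₁(α) < 1 (*"for M sufficiently large"*: θ = O(M^{−1}); `thm37_entry1_explicit`).
Conclusion: |(G′λ)(x)| ≤ NB₀c₁(α)(1 − N′θc₁(α))^{−1}(L^jη)²e^{−(1−α)δ₀d(y,y′)}|λ| for x ∈ Δ(y), supp λ ⊂ Δ(y′) — (3.42)₁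
for G′ with B₀ ↦ NB₀c₁(α)/(1 − N′θc₁(α)) and δ₀ ↦ (1 − α)δ₀, any 0 < α < 1 (p. 410: *"We can get a decay rate
arbitrarily close to the decay rate of the localized propagators"*).  Mechanism: `B6RandomWalk.majorant_of_fixedPoint_266`
((2.64)–(2.66) of [4]) fed by `hasMajorant_localSum` and `fixedPoint_of_388`.
[cite: Balaban1985BackgroundPropagators, Thm 3.7 + proof pp.409–410] -/
theorem thm37_entry1 (blk : X → g.Site) (d : ℕ) (δ₀ α θ B₀ N N' : ℝ) {ι : Type} [Fintype ι]
    (S S' : ι → Finset g.Site) (Tl Rl : ι → Module.End ℝ (X → ℝ)) {G' Δ : Module.End ℝ (X → ℝ)}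
    (hB₀ : 0 ≤ B₀) (hθ : 0 ≤ θ) (hN : 0 ≤ N) (hN' : 0 ≤ N') (hαδ : 0 ≤ (1 - α) * δ₀)
    (htri : B6RandomWalk.Triangle254 (B9Thm34Ext.toB6 g R H)) (hrefl : ∀ y : g.Site, g.dist y y = 0)
    (hdnn : ∀ y y' : g.Site, 0 ≤ g.dist y y')
    (h261 : B6RandomWalk.Ineq261 d (B9Thm34Ext.toB6 g R H) δ₀ α)
    (h263 : B6RandomWalk.Ineq263 d (B9Thm34Ext.toB6 g R H) δ₀ α)
    (hsmall : N' * θ * B6.c1 d δ₀ α < 1)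
    (hT : ∀ i, B6RandomWalk.HasMajorant (g := B9Thm34Ext.toB6 g R H) blk (Tl i)
      (fun (a b : g.Site) => if a ∈ S i then B₀ * g.len a ^ 2 * Real.exp (-(δ₀ * g.dist a b)) else 0))
    (hcnt : ∀ a : g.Site, (∑ i, if a ∈ S i then (1 : ℝ) else 0) ≤ N)
    (h389 : ∀ i, B6RandomWalk.HasMajorant (g := B9Thm34Ext.toB6 g R H) blk (Rl i)
      (fun (a b : g.Site) => if a ∈ S' i then θ * Real.exp (-(δ₀ * g.dist a b)) else 0))
    (hcnt' : ∀ a : g.Site, (∑ i, if a ∈ S' i then (1 : ℝ) else 0) ≤ N')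
    (hinv : G' * Δ = 1) (h388 : Δ * (∑ i, Tl i) = 1 - ∑ i, Rl i) :
    B6RandomWalk.HasMajorant (g := B9Thm34Ext.toB6 g R H) blk G'
      (fun (a b : g.Site) => N * B₀ * B6.c1 d δ₀ α * (1 - N' * θ * B6.c1 d δ₀ α)⁻¹ * g.len a ^ 2 *
        Real.exp (-((1 - α) * δ₀ * g.dist a b))) := by
  -- (3.87): G′₀ = Σ_□ h_□G′_□h_□ has majorant N·B₀(L^jη)²e^{−δ₀d} (localisation weights = indicators of the S_□)
  have hT' : ∀ i, B6RandomWalk.HasMajorant (g := B9Thm34Ext.toB6 g R H) blk (Tl i)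
      (fun (a b : g.Site) => (if a ∈ S i then (1 : ℝ) else 0) * (B₀ * g.len a ^ 2 * Real.exp (-(δ₀ * g.dist a b)))) :=
    fun i => B6RandomWalk.hasMajorant_mono (g := B9Thm34Ext.toB6 g R H) blk (hT i) fun a b => le_of_eq (by
      split_ifs <;> simp)
  have hG0 : B6RandomWalk.HasMajorant (g := B9Thm34Ext.toB6 g R H) blk (∑ i, Tl i)
      (fun (a b : g.Site) => N * B₀ * g.len a ^ 2 * Real.exp (-(δ₀ * g.dist a b))) := by
    have h := hasMajorant_localSum (G := B9Thm34Ext.toB6 g R H) blk Tl (fun i (a : g.Site) => if a ∈ S i then 1 else 0)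
      (fun (a b : g.Site) => B₀ * g.len a ^ 2 * Real.exp (-(δ₀ * g.dist a b))) N
      (fun a b => mul_nonneg (mul_nonneg hB₀ (sq_nonneg _)) (Real.exp_nonneg _)) hT' hcnt
    exact B6RandomWalk.hasMajorant_mono (g := B9Thm34Ext.toB6 g R H) blk h fun a b => le_of_eq (by
      ring)
  -- (3.89) summed: R′ = Σ_□ K(h_□)G′_□h_□ has majorant N′θ e^{−δ₀d}
  have h389' : ∀ i, B6RandomWalk.HasMajorant (g := B9Thm34Ext.toB6 g R H) blk (Rl i)
      (fun (a b : g.Site) => (if a ∈ S' i then (1 : ℝ) else 0) * (θ * Real.exp (-(δ₀ * g.dist a b)))) :=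
    fun i => B6RandomWalk.hasMajorant_mono (g := B9Thm34Ext.toB6 g R H) blk (h389 i) fun a b => le_of_eq (by
      split_ifs <;> simp)
  have hR : B6RandomWalk.HasMajorant (g := B9Thm34Ext.toB6 g R H) blk (∑ i, Rl i)
      (fun (a b : g.Site) => N' * θ * Real.exp (-(δ₀ * g.dist a b))) := by
    have h := hasMajorant_localSum (G := B9Thm34Ext.toB6 g R H) blk Rl (fun i (a : g.Site) => if a ∈ S' i then 1 else 0)
      (fun (a b : g.Site) => θ * Real.exp (-(δ₀ * g.dist a b))) N'
      (fun a b => mul_nonneg hθ (Real.exp_nonneg _)) h389' hcnt'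
    exact B6RandomWalk.hasMajorant_mono (g := B9Thm34Ext.toB6 g R H) blk h fun a b => le_of_eq (by
      ring)
  have hfix : G' = (∑ i, Tl i) + G' * ∑ i, Rl i := fixedPoint_of_388 hinv h388
  have h := B6RandomWalk.majorant_of_fixedPoint_266 (g := B9Thm34Ext.toB6 g R H) blk d δ₀ α (N' * θ) (N * B₀)
    (fun a => g.len a ^ 2) (mul_nonneg hN hB₀) (fun a => sq_nonneg _) (mul_nonneg hN' hθ) hαδ htri hrefl hdnn
    h261 h263 hsmall hG0 hR hfix
  refine B6RandomWalk.hasMajorant_mono (g := B9Thm34Ext.toB6 g R H) blk h fun a b => le_of_eq ?_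
  simp only [B9Thm34Ext.toB6_dist]

/-- **Theorem 3.7's "M sufficiently large", witnessed on this entry.**  With O(M^{−1}) = θ₀M^{−1} in (3.89) (θ₀ > 0
depending on d, L) and the EXPLICIT threshold M ≥ M₂ := 2N′θ₀c₁(α): N′θ₀M^{−1}c₁(α) ≤ ½, and G′ obeys (3.42)₁ with
constant 2NB₀c₁(α) and rate (1 − α)δ₀ — Theorem 3.1's *"There exist positive constants M₁, δ₀, B₀, depending on d
and L only"* on the first entry, with M₁ = M₂, B₀ ↦ 2NB₀c₁(α), δ₀ ↦ (1 − α)δ₀ (N, N′ the overlap counts of the cubes,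
B₀, δ₀ the constants of Corollary 3.6, c₁(α) = 12c₀(½α)^d the row-sum constant of [4] Lemma 2.1 (2.61), `B6.c1`).
[cite: Balaban1985BackgroundPropagators, Thm 3.1 p.397 + Thm 3.7 pp.409–410] -/
theorem thm37_entry1_explicit (blk : X → g.Site) (d : ℕ) (δ₀ α θ₀ B₀ N N' : ℝ) {ι : Type} [Fintype ι]
    (S S' : ι → Finset g.Site) (Tl Rl : ι → Module.End ℝ (X → ℝ)) {G' Δ : Module.End ℝ (X → ℝ)}
    (hB₀ : 0 ≤ B₀) (hθ₀ : 0 < θ₀) (hN : 0 ≤ N) (hN' : 0 ≤ N') (hαδ : 0 ≤ (1 - α) * δ₀)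
    (hc₁ : 0 < B6.c1 d δ₀ α) (hM : 0 < g.M) (hM₂ : 2 * N' * θ₀ * B6.c1 d δ₀ α ≤ g.M)
    (htri : B6RandomWalk.Triangle254 (B9Thm34Ext.toB6 g R H)) (hrefl : ∀ y : g.Site, g.dist y y = 0)
    (hdnn : ∀ y y' : g.Site, 0 ≤ g.dist y y')
    (h261 : B6RandomWalk.Ineq261 d (B9Thm34Ext.toB6 g R H) δ₀ α)
    (h263 : B6RandomWalk.Ineq263 d (B9Thm34Ext.toB6 g R H) δ₀ α)
    (hT : ∀ i, B6RandomWalk.HasMajorant (g := B9Thm34Ext.toB6 g R H) blk (Tl i)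
      (fun (a b : g.Site) => if a ∈ S i then B₀ * g.len a ^ 2 * Real.exp (-(δ₀ * g.dist a b)) else 0))
    (hcnt : ∀ a : g.Site, (∑ i, if a ∈ S i then (1 : ℝ) else 0) ≤ N)
    (h389 : ∀ i, B6RandomWalk.HasMajorant (g := B9Thm34Ext.toB6 g R H) blk (Rl i)
      (fun (a b : g.Site) => if a ∈ S' i then θ₀ * g.M⁻¹ * Real.exp (-(δ₀ * g.dist a b)) else 0))
    (hcnt' : ∀ a : g.Site, (∑ i, if a ∈ S' i then (1 : ℝ) else 0) ≤ N')
    (hinv : G' * Δ = 1) (h388 : Δ * (∑ i, Tl i) = 1 - ∑ i, Rl i) :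
    B6RandomWalk.HasMajorant (g := B9Thm34Ext.toB6 g R H) blk G'
      (fun (a b : g.Site) => 2 * N * B₀ * B6.c1 d δ₀ α * g.len a ^ 2 * Real.exp (-((1 - α) * δ₀ * g.dist a b))) := by
  set c : ℝ := B6.c1 d δ₀ α with hcdef
  have hθ : 0 ≤ θ₀ * g.M⁻¹ := mul_nonneg hθ₀.le (inv_nonneg.mpr hM.le)
  -- N′ θ₀ M⁻¹ c ≤ 1/2 from 2 N′ θ₀ c ≤ M
  have hq : N' * (θ₀ * g.M⁻¹) * c ≤ 1 / 2 := by
    have h1 : N' * (θ₀ * g.M⁻¹) * c = (N' * θ₀ * c) / g.M := by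
      rw [div_eq_mul_inv]; ring
    rw [h1, div_le_iff₀ hM]
    linarith
  have hsmall : N' * (θ₀ * g.M⁻¹) * c < 1 := by linarith
  have hinv' : (1 - N' * (θ₀ * g.M⁻¹) * c)⁻¹ ≤ 2 := by
    rw [inv_le_comm₀ (by linarith) (by norm_num : (0 : ℝ) < 2)]
    linarith
  have h := thm37_entry1 (R := R) (H := H) blk d δ₀ α (θ₀ * g.M⁻¹) B₀ N N' S S' Tl Rl hB₀ hθ hN hN' hαδ htri
    hrefl hdnn h261 h263 hsmall hT hcnt h389 hcnt' hinv h388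
  refine B6RandomWalk.hasMajorant_mono (g := B9Thm34Ext.toB6 g R H) blk h fun a b => ?_
  have hE : 0 ≤ g.len a ^ 2 * Real.exp (-((1 - α) * δ₀ * g.dist a b)) :=
    mul_nonneg (sq_nonneg _) (Real.exp_nonneg _)
  have hNBc : 0 ≤ N * B₀ * c := mul_nonneg (mul_nonneg hN hB₀) hc₁.le
  have key : N * B₀ * c * (1 - N' * (θ₀ * g.M⁻¹) * c)⁻¹ ≤ 2 * N * B₀ * c := by
    calc N * B₀ * c * (1 - N' * (θ₀ * g.M⁻¹) * c)⁻¹ ≤ N * B₀ * c * 2 :=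
          mul_le_mul_of_nonneg_left hinv' hNBc
      _ = 2 * N * B₀ * c := by ring
  calc N * B₀ * c * (1 - N' * (θ₀ * g.M⁻¹) * c)⁻¹ * g.len a ^ 2 * Real.exp (-((1 - α) * δ₀ * g.dist a b))
      = N * B₀ * c * (1 - N' * (θ₀ * g.M⁻¹) * c)⁻¹ *
          (g.len a ^ 2 * Real.exp (-((1 - α) * δ₀ * g.dist a b))) := by ring
    _ ≤ 2 * N * B₀ * c * (g.len a ^ 2 * Real.exp (-((1 - α) * δ₀ * g.dist a b))) :=
        mul_le_mul_of_nonneg_right key hE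
    _ = _ := by ring

end Thm37

/-! ## §6  Corollary 3.8: the bound (3.94) on one term of (3.90), and the sum over walks (Proposition 1.2 [3] route) -/

section Cor38

variable {g : B9.Geometry} [Fintype g.Site] [DecidableEq g.Site] {R : ℝ} {H : Prop} {X : Type}

/-- **Corollary 3.8, the estimate (3.91)–(3.92) ⇒ (3.94), constants explicit.**  A walk ω = (□₀, □₁, …, □ₙ) enters
through its factors F 0 = h_{□₀}G′_{□₀}h_{□₀} (majorant 1_{S₀}(y)B₀(L^jη)²e^{−δ₀d(y,z)}: Cor. 3.6 entry 1, localized —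
`hT0`) and F i = K(h_{□ᵢ})G′_{□ᵢ}h_{□ᵢ}, i = 1, …, n (majorant 1_{Sᵢ}(y)θe^{−δ₀d(y,z)}: (3.89), localized — `hR`; Sᵢ =
□ᵢ ∩ 𝔅 in print), Lemma 2.1 of [4] at the exponent α ((2.61): `h261`; α = ½ in print) and an admissible lower bound
dω(y, y′) of the path lengths (3.93) (`hdω`; the printed d(ω, y, y′) is the largest one, d(y, y′) is one by `LB_dist`).
Then the term F 0·F 1⋯F n of (3.90) satisfies |(h_{□₀}G′_{□₀}h_{□₀}Π_{i=1}^nK(h_{□ᵢ})G′_{□ᵢ}h_{□ᵢ}λ)(x)| ≤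
1_{S₀}(y)B₀(L^jη)²(θc₁(α))ⁿe^{−(1−α)δ₀dω(y,y′)}|λ| for x ∈ Δ(y), supp λ ⊂ Δ(y′) — i.e. (3.94) with O(1) = B₀,
O(M^{−1/2})^{|ω|}M^{−½|ω|} = (θc₁(α))ⁿ (θ = O(M^{−1}); `cor38_bound_394` splits it as printed) and the rate (1 − α)δ₀
(= ½δ₀ for α = ½).  Mechanism: `hasMajorant_lprod` ((3.91)) + `lchain_weight_le` ((3.92)).
[cite: Balaban1985BackgroundPropagators, Cor. 3.8 (3.91)–(3.94) p.410] -/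
theorem cor38_walk_majorant (blk : X → g.Site) (d : ℕ) (δ₀ α θ B₀ : ℝ) (S : ℕ → Finset g.Site)
    (F : ℕ → Module.End ℝ (X → ℝ)) (dω : g.Site → g.Site → ℝ) (n : ℕ)
    (hB₀ : 0 ≤ B₀) (hθ : 0 ≤ θ) (hdnn : ∀ y y' : g.Site, 0 ≤ g.dist y y') (hαδ : 0 ≤ α * δ₀)
    (h1αδ : 0 ≤ (1 - α) * δ₀) (h261 : B6RandomWalk.Ineq261 d (B9Thm34Ext.toB6 g R H) δ₀ α)
    (hT0 : B6RandomWalk.HasMajorant (g := B9Thm34Ext.toB6 g R H) blk (F 0)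
      (fun (a b : g.Site) => if a ∈ S 0 then B₀ * g.len a ^ 2 * Real.exp (-(δ₀ * g.dist a b)) else 0))
    (hR : ∀ i, 1 ≤ i → i ≤ n → B6RandomWalk.HasMajorant (g := B9Thm34Ext.toB6 g R H) blk (F i)
      (fun (a b : g.Site) => if a ∈ S i then θ * Real.exp (-(δ₀ * g.dist a b)) else 0))
    (hdω : ∀ a b : g.Site, LB g.dist S n a b (dω a b)) :
    B6RandomWalk.HasMajorant (g := B9Thm34Ext.toB6 g R H) blk (lprod F n)
      (fun (a b : g.Site) => (if a ∈ S 0 then B₀ * g.len a ^ 2 else 0) * (θ * B6.c1 d δ₀ α) ^ n *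
        Real.exp (-((1 - α) * δ₀ * dω a b))) := by
  -- the weights: w 0 = 1_{S₀}B₀(L^jη)², w i = 1_{Sᵢ}θ (i ≥ 1)
  let w : ℕ → g.Site → ℝ := fun i a => if a ∈ S i then (if i = 0 then B₀ * g.len a ^ 2 else θ) else 0
  have hw0 : ∀ i a, 0 ≤ w i a := fun i a => by
    simp only [w]
    split_ifs
    · exact mul_nonneg hB₀ (sq_nonneg _)
    · exact hθ
    · exact le_rfl
  have hwΘ : ∀ i a, 1 ≤ i → w i a ≤ θ := fun i a hi => by
    have hi' : i ≠ 0 := by omega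
    simp only [w, hi', if_false]
    split_ifs
    · exact le_rfl
    · exact hθ
  have hwS : ∀ i a, 1 ≤ i → a ∉ S i → w i a = 0 := fun i a _ ha => by
    simp only [w, ha, if_false]
  have hK : ∀ i ≤ n, B6RandomWalk.HasMajorant (g := B9Thm34Ext.toB6 g R H) blk (F i)
      (fun (a b : g.Site) => w i a * Real.exp (-(δ₀ * g.dist a b))) := by
    intro i hin
    by_cases hi : i = 0
    · subst hi
      refine B6RandomWalk.hasMajorant_mono (g := B9Thm34Ext.toB6 g R H) blk hT0 fun a b => le_of_eq ?_
      simp only [w, if_true]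
      split_ifs <;> ring
    · refine B6RandomWalk.hasMajorant_mono (g := B9Thm34Ext.toB6 g R H) blk (hR i (by omega) hin) fun a b =>
        le_of_eq ?_
      simp only [w, hi, if_false]
      split_ifs <;> ring
  have hKnn : ∀ i ≤ n, ∀ (a b : g.Site), 0 ≤ w i a * Real.exp (-(δ₀ * g.dist a b)) := fun i _ a b =>
    mul_nonneg (hw0 i a) (Real.exp_nonneg _)
  have hprod := hasMajorant_lprod (G := B9Thm34Ext.toB6 g R H) blk F
    (fun i (a b : g.Site) => w i a * Real.exp (-(δ₀ * g.dist a b))) n hK hKnn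
  refine B6RandomWalk.hasMajorant_mono (g := B9Thm34Ext.toB6 g R H) blk hprod fun a b => ?_
  have hch := lchain_weight_le (St := g.Site) g.dist δ₀ α (B6.c1 d δ₀ α) θ hdnn hαδ h1αδ hθ h261 n S w
    (fun i _ a => hw0 i a) (fun i hi _ a => hwΘ i a hi) (fun i hi _ a ha => hwS i a hi ha) a b (dω a b) (hdω a b)
  refine hch.trans (le_of_eq ?_)
  simp only [w, if_true]

/-- **(3.94) in print shape** (α = ½, O(M^{−1}) = θ₀M^{−1}): for x ∈ Δ(y), y ∈ S₀ (= □₀ ∩ Λ_j) and supp λ ⊂ Δ(y′),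
|(h_{□₀}G′_{□₀}h_{□₀}Π_{i=1}^nK(h_{□ᵢ})G′_{□ᵢ}h_{□ᵢ}λ)(x)| ≤ (L^jη)²·[B₀·(θ₀c₁(½)M^{−1/2})ⁿ·M^{−n/2}·e^{−½δ₀dω(y,y′)}]·|λ| =
(L^jη)²·`B9.walkFactor B₀ (θ₀c₁(½)) M δ₀ n (dω y y′)`·|λ| — the printed *"O(1)(L^jη)²O(M^{−1/2})^{|ω|}M^{−1/2|ω|}
e^{−(1/2)δ₀d(ω,y,y′)}|Δ(y′)λ|"* with O(1) = B₀ and O(M^{−1/2}) = θ₀c₁(½)M^{−1/2} identified (the split (θ₀c₁M^{−1})ⁿ =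
(θ₀c₁M^{−1/2})ⁿM^{−n/2} is gen-1's `B9.split_small_factor`). [cite: Balaban1985BackgroundPropagators, Cor. 3.8 (3.94) p.410] -/
theorem cor38_bound_394 (blk : X → g.Site) (d : ℕ) (δ₀ θ₀ B₀ : ℝ) (S : ℕ → Finset g.Site)
    (F : ℕ → Module.End ℝ (X → ℝ)) (dω : g.Site → g.Site → ℝ) (n : ℕ)
    (hB₀ : 0 ≤ B₀) (hθ₀ : 0 ≤ θ₀) (hM : 0 < g.M) (hdnn : ∀ y y' : g.Site, 0 ≤ g.dist y y') (hδ₀ : 0 ≤ δ₀)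
    (h261 : B6RandomWalk.Ineq261 d (B9Thm34Ext.toB6 g R H) δ₀ (1 / 2))
    (hT0 : B6RandomWalk.HasMajorant (g := B9Thm34Ext.toB6 g R H) blk (F 0)
      (fun (a b : g.Site) => if a ∈ S 0 then B₀ * g.len a ^ 2 * Real.exp (-(δ₀ * g.dist a b)) else 0))
    (hR : ∀ i, 1 ≤ i → i ≤ n → B6RandomWalk.HasMajorant (g := B9Thm34Ext.toB6 g R H) blk (F i)
      (fun (a b : g.Site) => if a ∈ S i then θ₀ * g.M⁻¹ * Real.exp (-(δ₀ * g.dist a b)) else 0))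
    (hdω : ∀ a b : g.Site, LB g.dist S n a b (dω a b))
    (y' : g.Site) (μ : X → ℝ) (B : ℝ) (hμ : B6RandomWalk.BlockSupp (g := B9Thm34Ext.toB6 g R H) blk μ y' B)
    (x : X) (hx : blk x ∈ S 0) :
    |lprod F n μ x| ≤
      g.len (blk x) ^ 2 * B9.walkFactor B₀ (θ₀ * B6.c1 d δ₀ (1 / 2)) g.M δ₀ n (dω (blk x) y') * B := by
  have hαδ : 0 ≤ (1 / 2 : ℝ) * δ₀ := by linarith
  have h1αδ : 0 ≤ (1 - 1 / 2 : ℝ) * δ₀ := by linarith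
  have h := cor38_walk_majorant (R := R) (H := H) blk d δ₀ (1 / 2) (θ₀ * g.M⁻¹) B₀ S F dω n hB₀
    (mul_nonneg hθ₀ (inv_nonneg.mpr hM.le)) hdnn hαδ h1αδ h261 hT0 hR hdω y' μ B hμ x
  refine h.trans (le_of_eq ?_)
  beta_reduce
  have hexp : Real.exp (-((1 - 1 / 2) * δ₀ * dω (blk x) y')) = Real.exp (-(δ₀ / 2 * dω (blk x) y')) := by
    congr 1; ring
  rw [hexp, if_pos hx]
  set c : ℝ := B6.c1 d δ₀ (1 / 2) with hc
  unfold B9.walkFactor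
  have hsplit := B9.split_small_factor (θ₀ * c) g.M hM n
  have hpow : (θ₀ * g.M⁻¹ * c) ^ n = (θ₀ * c * g.M ^ (-(1 / 2 : ℝ))) ^ n * g.M ^ (-((n : ℝ) / 2)) := by
    rw [← hsplit]; ring
  rw [hpow]
  ring

/-- **The sum over walks, Proposition 1.2 [3] route** (p. 410: *"We will use the factor O(M^{−1/2}) to control the
sum over random walks ω"*).  Index the cubes by a finite type with `nbrs □` = the cubes meeting □ (at most D of them,
`hD`); let W ω be the term of (3.90) for the walk ω (a list □₀ :: ⋯), with the (3.94)-type majorant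
1_{S_{□₀}}(y)B₀(L^jη)²qⁿe^{−δ′d(y,y′)} for ω ∈ `walksFrom nbrs n □₀` (`hW`; q = θc₁(α), δ′ = (1 − α)δ₀ from
`cor38_walk_majorant` + `LB_dist`), and let every coarse site lie in at most N of the S_□ (`hcnt`).  If Dq ≤ ½
(*"M sufficiently large"*: q = O(M^{−1})) then EVERY partial sum Σ_{n<m}Σ_{□₀}Σ_{ω} W ω of the expansion (3.90) has
the majorant 2NB₀(L^jη)²e^{−δ′d(y,y′)}, uniformly in m — the convergence *"in the norm"* of (3.42)₁ with the constant
explicit (geometric series: gen-1's `B9.walkSum_le`). [cite: Balaban1985BackgroundPropagators, Thm 3.7/Cor. 3.8 pp.409–410] -/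
theorem walkSum_majorant (blk : X → g.Site) {ι : Type} [Fintype ι] [DecidableEq ι] (nbrs : ι → Finset ι)
    (D : ℕ) (hD : ∀ c, (nbrs c).card ≤ D) (S : ι → Finset g.Site) (W : List ι → Module.End ℝ (X → ℝ))
    (B₀ q δ' N : ℝ) (hB₀ : 0 ≤ B₀) (hq : 0 ≤ q) (hN : 0 ≤ N) (hDq : (D : ℝ) * q ≤ 1 / 2)
    (hW : ∀ (n : ℕ) (c : ι), ∀ ω ∈ walksFrom nbrs n c,
      B6RandomWalk.HasMajorant (g := B9Thm34Ext.toB6 g R H) blk (W ω)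
        (fun (a b : g.Site) => (if a ∈ S c then B₀ * g.len a ^ 2 else 0) * q ^ n * Real.exp (-(δ' * g.dist a b))))
    (hcnt : ∀ a : g.Site, (∑ c, if a ∈ S c then (1 : ℝ) else 0) ≤ N) (m : ℕ) :
    B6RandomWalk.HasMajorant (g := B9Thm34Ext.toB6 g R H) blk
      (∑ n ∈ Finset.range m, ∑ c, ∑ ω ∈ walksFrom nbrs n c, W ω)
      (fun (a b : g.Site) => 2 * N * B₀ * g.len a ^ 2 * Real.exp (-(δ' * g.dist a b))) := by
  -- level n, cube c: at most D^n walks, each with the same majorant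
  have hlevel : ∀ n c, B6RandomWalk.HasMajorant (g := B9Thm34Ext.toB6 g R H) blk (∑ ω ∈ walksFrom nbrs n c, W ω)
      (fun (a b : g.Site) => (D : ℝ) ^ n * ((if a ∈ S c then B₀ * g.len a ^ 2 else 0) * q ^ n *
        Real.exp (-(δ' * g.dist a b)))) := by
    intro n c
    refine B6RandomWalk.hasMajorant_mono (g := B9Thm34Ext.toB6 g R H) blk
      (hasMajorant_finsetSum (G := B9Thm34Ext.toB6 g R H) blk (walksFrom nbrs n c) W
        (fun _ (a b : g.Site) => (if a ∈ S c then B₀ * g.len a ^ 2 else 0) * q ^ n * Real.exp (-(δ' * g.dist a b)))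
        (hW n c)) fun a b => ?_
    have hnn : 0 ≤ (if a ∈ S c then B₀ * g.len a ^ 2 else 0) * q ^ n * Real.exp (-(δ' * g.dist a b)) :=
      mul_nonneg (mul_nonneg (by split_ifs <;> first | exact mul_nonneg hB₀ (sq_nonneg _) | exact le_rfl)
        (pow_nonneg hq n)) (Real.exp_nonneg _)
    rw [Finset.sum_const, nsmul_eq_mul]
    refine mul_le_mul_of_nonneg_right ?_ hnn
    exact_mod_cast card_walksFrom_le nbrs hD n c
  -- sum over the initial cube: the overlap count N
  have hn : ∀ n, B6RandomWalk.HasMajorant (g := B9Thm34Ext.toB6 g R H) blk (∑ c, ∑ ω ∈ walksFrom nbrs n c, W ω)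
      (fun (a b : g.Site) => N * B₀ * g.len a ^ 2 * Real.exp (-(δ' * g.dist a b)) * ((D : ℝ) * q) ^ n) := by
    intro n
    refine B6RandomWalk.hasMajorant_mono (g := B9Thm34Ext.toB6 g R H) blk
      (hasMajorant_finsetSum (G := B9Thm34Ext.toB6 g R H) blk Finset.univ _ _ fun c _ => hlevel n c) fun a b => ?_
    have hE : 0 ≤ B₀ * g.len a ^ 2 * Real.exp (-(δ' * g.dist a b)) * ((D : ℝ) * q) ^ n :=
      mul_nonneg (mul_nonneg (mul_nonneg hB₀ (sq_nonneg _)) (Real.exp_nonneg _))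
        (pow_nonneg (mul_nonneg (Nat.cast_nonneg D) hq) n)
    calc ∑ c, (D : ℝ) ^ n * ((if a ∈ S c then B₀ * g.len a ^ 2 else 0) * q ^ n * Real.exp (-(δ' * g.dist a b)))
        = (∑ c, if a ∈ S c then (1 : ℝ) else 0) *
            (B₀ * g.len a ^ 2 * Real.exp (-(δ' * g.dist a b)) * ((D : ℝ) * q) ^ n) := by
          rw [Finset.sum_mul]
          refine Finset.sum_congr rfl fun c _ => ?_
          split_ifs <;> ring
      _ ≤ N * (B₀ * g.len a ^ 2 * Real.exp (-(δ' * g.dist a b)) * ((D : ℝ) * q) ^ n) :=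
          mul_le_mul_of_nonneg_right (hcnt a) hE
      _ = _ := by ring
  -- sum over n < m: geometric series with ratio Dq ≤ ½
  refine B6RandomWalk.hasMajorant_mono (g := B9Thm34Ext.toB6 g R H) blk
    (hasMajorant_finsetSum (G := B9Thm34Ext.toB6 g R H) blk (Finset.range m) _ _ fun n _ => hn n) fun a b => ?_
  have hC : 0 ≤ N * B₀ * g.len a ^ 2 * Real.exp (-(δ' * g.dist a b)) :=
    mul_nonneg (mul_nonneg (mul_nonneg hN hB₀) (sq_nonneg _)) (Real.exp_nonneg _)
  have hgeom := B9.walkSum_le (N * B₀ * g.len a ^ 2 * Real.exp (-(δ' * g.dist a b))) ((D : ℝ) * q)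
    (fun _ => 1) (fun n => N * B₀ * g.len a ^ 2 * Real.exp (-(δ' * g.dist a b)) * ((D : ℝ) * q) ^ n) hC
    (mul_nonneg (Nat.cast_nonneg D) hq) hDq (fun n => le_of_eq (one_mul _)) m
  calc ∑ n ∈ Finset.range m, N * B₀ * g.len a ^ 2 * Real.exp (-(δ' * g.dist a b)) * ((D : ℝ) * q) ^ n
      = ∑ n ∈ Finset.range m, 1 * (N * B₀ * g.len a ^ 2 * Real.exp (-(δ' * g.dist a b)) * ((D : ℝ) * q) ^ n) := by
        simp only [one_mul]
    _ ≤ 2 * (N * B₀ * g.len a ^ 2 * Real.exp (-(δ' * g.dist a b))) := hgeom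
    _ = _ := by ring

end Cor38

end Literature.MathematicalPhysics.QuantumFieldTheory.Balaban1983to89.B9Thm37Sum
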